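import Literature.Barriers.CriticalPhenomena.PlanarEdwardsModelDiffusiveProofs
import HarnessLib

/-!
# The pair covariance kernel of the planar simple random walk (definitions)

Sibling file of `…PlanarEdwardsModelDiffusiveProofs` (objects `Edwards2D.StepSeq`, `pos`,
`endpoint`, `selfIntersections`, the block independence `expect_append` / `expect_increments` and
the two-pair bounds `expect_nested_le` / `expect_crossed_le`). It names the objects of the
four-fold covariance sum `Var(J) = Σ_{(i,j),(k,l)} Cov(𝟙{ω(i) = ω(j)}, 𝟙{ω(k) = ω(l)})` of
Lawler's Proposition 6.4.1 (the sets `A¹, A², A³` of pairs of pairs of times in its proof) and of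
Stoll's second-moment computations (Math. Scand. 64 (1989), §§1–3), so that the limits (α₁), (α₂)
behind `Edwards2D.Stoll1989_invariance_of_secondMomentLimits` can be stated and proved about
named quantities:

* `Edwards2D.prob m y = P[ω(m) = y]` — the point probabilities of the `m`-step walk;
* `Edwards2D.pairJoint A B C = P[X_A + Y_B = 0, Y_B + W_C = 0]` for three independent walks of
  `A`, `B`, `C` steps — the joint vanishing probability of two increments sharing `B` steps
  (`= Σ_y p_A(y) p_B(y) p_C(y)`);
* `Edwards2D.pairKernel A B C = pairJoint A B C - p_{A+B}(0) p_{B+C}(0)` — the covariance of the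
  two vanishing events, as a function of the overlap data `(A, B, C)` = (steps private to the
  first pair, shared steps, steps private to the second pair);
* `Edwards2D.overlapLen i j k l` — the number `B` of steps shared by the time pairs `{i, j}` and
  `{k, l}`, and `Edwards2D.pairKernelAt r i j k l = pairKernel A B (C + 2r)` — the kernel at the
  overlap data of the two pairs, the second pair lengthened by `2r` private steps (`r = 0`: the
  covariance of `𝟙{ω(i) = ω(j)}` and `𝟙{ω(k) = ω(l)}`; `r > 0`: of `𝟙{ω(i) = ω(j)}` and the
  heat-kernel smoothing `p_{2r}(ω(l) - ω(k))`);
* `Edwards2D.coreSum r M = Σ_{i,j,k,l < M} pairKernelAt r i j k l` — the four-fold sum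
  (`Var(J_n) = ¼ coreSum 0 (n+1)`, proved in the sibling `…PairKernelCovariance`).

PROVED here (API): `prob_neg`, `prob_add_zero` (Chapman–Kolmogorov at the origin),
`pairJoint_comm`, `pairJoint_zero_mid/right/left`, `pairKernel_comm`, `pairKernel_zero_mid`
(separated pairs are uncorrelated), `pairKernel_zero_right/left` (nested pairs:
`K(A,B,0) = p_B(0)(p_A(0) - p_{A+B}(0))`), the bounds `0 ≤ prob ≤ 1`, `|pairKernel| ≤ 1`, and the
symmetries of `overlapLen` / `pairKernelAt`.

## References

* G. F. Lawler, *Intersections of Random Walks* (1991), Proposition 6.4.1 and its proof.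
  [Lawler1991]
* A. Stoll, *Invariance principles for Brownian intersection local time and polymer measures*,
  Math. Scand. 64 (1989), 133–160, §1 (Prop. 1.10) and §3. [Stoll1989]
-/

noncomputable section

open Finset Real
open scoped BigOperators

namespace Literature.Barriers.CriticalPhenomena

namespace Edwards2D

open Literature.Probability.LatticeModels Literature.Probability.Percolation

variable {m n : ℕ}

/-! ### Point probabilities -/

/-- The point probabilities `p_m(y) = P[ω(m) = y]` of the `m`-step planar simple random walk.
[cite: Lawler1991, §1.2 (p_n(x))] -/
def prob (m : ℕ) (y : Site 2) : ℝ := 𝔼 ω : StepSeq m, (if endpoint ω = y then (1 : ℝ) else 0)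

/-- Unfolding `prob`. [folklore] -/
theorem prob_eq (m : ℕ) (y : Site 2) :
    prob m y = 𝔼 ω : StepSeq m, (if endpoint ω = y then (1 : ℝ) else 0) := rfl

/-- `0 ≤ p_m(y)`. [folklore] -/
theorem prob_nonneg (m : ℕ) (y : Site 2) : 0 ≤ prob m y :=
  expect_nonneg fun _ _ => by split_ifs <;> norm_num

/-- `p_m(y) ≤ 1`. [folklore] -/
theorem prob_le_one (m : ℕ) (y : Site 2) : prob m y ≤ 1 := by
  unfold prob
  calc 𝔼 ω : StepSeq m, (if endpoint ω = y then (1 : ℝ) else 0) ≤ 𝔼 _ω : StepSeq m, (1 : ℝ) :=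
        expect_le_expect fun ω _ => by split_ifs <;> norm_num
    _ = 1 := Finset.expect_const univ_nonempty _

/-- `p_m(y) ≤ 1/(m+1)` (the crude local bound `expect_ite_endpoint_eq_le`).
[cite: Lawler1991, Theorem 1.2.1] -/
theorem prob_le_inv (m : ℕ) (y : Site 2) : prob m y ≤ 1 / ((m : ℝ) + 1) :=
  expect_ite_endpoint_eq_le m y

/-- Symmetry `p_m(-y) = p_m(y)`. [folklore] -/
theorem prob_neg (m : ℕ) (y : Site 2) : prob m (-y) = prob m y := by
  unfold prob
  rw [← expect_neg_endpoint (fun z => if z = y then (1 : ℝ) else 0)]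
  exact Finset.expect_congr rfl fun ω _ => by simp only [neg_eq_iff_eq_neg]

/-- **Chapman–Kolmogorov at the origin**: `p_{A+B}(0) = P[X_A + Y_B = 0]` for independent walks.
[cite: Lawler1991, §1.3 (Theorem 1.3.2)] -/
theorem prob_add_zero (A B : ℕ) :
    prob (A + B) 0 = 𝔼 α : StepSeq A, 𝔼 β : StepSeq B,
      (if endpoint α + endpoint β = 0 then (1 : ℝ) else 0) := by
  unfold prob
  rw [expect_append (m := A) (k := B)]
  simp only [endpoint_append]

/-- `p_{A+B}(y) = 𝔼_β p_A(y - Y_B)`: the law of the endpoint of `A + B` steps is the convolution.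
[cite: Lawler1991, §1.3 (Theorem 1.3.2)] -/
theorem prob_add (A B : ℕ) (y : Site 2) :
    prob (A + B) y = 𝔼 α : StepSeq A, 𝔼 β : StepSeq B,
      (if endpoint α + endpoint β = y then (1 : ℝ) else 0) := by
  unfold prob
  rw [expect_append (m := A) (k := B)]
  simp only [endpoint_append]

/-- The walk of `0` steps sits at the origin. [folklore] -/
theorem endpoint_stepSeq_zero (γ : StepSeq 0) : endpoint γ = 0 := by
  simp [endpoint]

/-- `p_0(y) = 𝟙{y = 0}`. [folklore] -/
theorem prob_zero_left (y : Site 2) : prob 0 y = if y = 0 then 1 else 0 := by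
  unfold prob
  rw [Finset.expect_congr rfl fun γ _ => by rw [endpoint_stepSeq_zero γ],
    Finset.expect_const univ_nonempty]
  by_cases h : y = 0
  · rw [if_pos h, if_pos h.symm]
  · rw [if_neg h, if_neg (Ne.symm h)]

/-! ### The joint vanishing probability and the covariance kernel -/

/-- **The joint vanishing probability** `j(A,B,C) = P[X_A + Y_B = 0, Y_B + W_C = 0]` for three
independent planar walks `X, Y, W` of `A, B, C` steps: the probability that two increments of the
walk sharing `B` steps, with `A` resp. `C` private steps, both vanish (Lawler's crossed pairs
`A³`; `= Σ_y p_A(y) p_B(y) p_C(y)`). [cite: Lawler1991, Proposition 6.4.1 (proof)] -/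
def pairJoint (A B C : ℕ) : ℝ :=
  𝔼 α : StepSeq A, 𝔼 β : StepSeq B, 𝔼 γ : StepSeq C,
    (if endpoint α + endpoint β = 0 then (1 : ℝ) else 0) *
      (if endpoint β + endpoint γ = 0 then (1 : ℝ) else 0)

/-- **The pair covariance kernel** `K(A,B,C) = j(A,B,C) - p_{A+B}(0) p_{B+C}(0)`: the covariance
of the vanishing of two increments with overlap data `(A, B, C)`.
[cite: Lawler1991, Proposition 6.4.1 (proof)] [cite: Stoll1989, §1, Proposition 1.10] -/
def pairKernel (A B C : ℕ) : ℝ := pairJoint A B C - prob (A + B) 0 * prob (B + C) 0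

/-- `0 ≤ j(A,B,C)`. [folklore] -/
theorem pairJoint_nonneg (A B C : ℕ) : 0 ≤ pairJoint A B C :=
  expect_nonneg fun _ _ => expect_nonneg fun _ _ => expect_nonneg fun _ _ =>
    mul_nonneg (by split_ifs <;> norm_num) (by split_ifs <;> norm_num)

/-- `j(A,B,C) ≤ P[X_A + Y_B = 0] = p_{A+B}(0)` (drop the second event). [folklore] -/
theorem pairJoint_le_prob_left (A B C : ℕ) : pairJoint A B C ≤ prob (A + B) 0 := by
  rw [prob_add_zero]
  unfold pairJoint
  refine expect_le_expect fun α _ => expect_le_expect fun β _ => ?_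
  calc 𝔼 γ : StepSeq C, (if endpoint α + endpoint β = 0 then (1 : ℝ) else 0) *
        (if endpoint β + endpoint γ = 0 then (1 : ℝ) else 0)
      ≤ 𝔼 _γ : StepSeq C, (if endpoint α + endpoint β = 0 then (1 : ℝ) else 0) :=
        expect_le_expect fun γ _ => by
          refine mul_le_of_le_one_right (by split_ifs <;> norm_num) (by split_ifs <;> norm_num)
    _ = _ := Finset.expect_const univ_nonempty _

/-- `j(A,B,C) ≤ 1`. [folklore] -/
theorem pairJoint_le_one (A B C : ℕ) : pairJoint A B C ≤ 1 :=
  (pairJoint_le_prob_left A B C).trans (prob_le_one _ _)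

/-- `|K(A,B,C)| ≤ 1`. [folklore] -/
theorem abs_pairKernel_le_one (A B C : ℕ) : |pairKernel A B C| ≤ 1 := by
  unfold pairKernel
  have h1 := pairJoint_nonneg A B C
  have h2 := pairJoint_le_one A B C
  have h3 : 0 ≤ prob (A + B) 0 * prob (B + C) 0 := mul_nonneg (prob_nonneg _ _) (prob_nonneg _ _)
  have h4 : prob (A + B) 0 * prob (B + C) 0 ≤ 1 :=
    mul_le_one₀ (prob_le_one _ _) (prob_nonneg _ _) (prob_le_one _ _)
  rw [abs_le]; constructor <;> linarith

/-- **Symmetry** `j(A,B,C) = j(C,B,A)` (swap the roles of the two pairs). [folklore] -/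
theorem pairJoint_comm (A B C : ℕ) : pairJoint A B C = pairJoint C B A := by
  unfold pairJoint
  conv_rhs => rw [Finset.expect_comm]
  rw [Finset.expect_comm]
  refine Finset.expect_congr rfl fun β _ => ?_
  rw [Finset.expect_comm]
  refine Finset.expect_congr rfl fun γ _ => Finset.expect_congr rfl fun α _ => ?_
  conv_lhs => rw [mul_comm, add_comm (endpoint β) (endpoint γ), add_comm (endpoint α) (endpoint β)]

/-- **Separated pairs**: `j(A,0,C) = p_A(0) p_C(0)` (no shared steps: the two events are
independent). [cite: Lawler1991, Proposition 6.4.1 (proof, the set A¹)] -/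
theorem pairJoint_zero_mid (A C : ℕ) : pairJoint A 0 C = prob A 0 * prob C 0 := by
  unfold pairJoint prob
  rw [Finset.expect_mul_expect]
  refine Finset.expect_congr rfl fun α _ => ?_
  rw [Finset.expect_congr rfl fun β _ => by rw [endpoint_stepSeq_zero β],
    Finset.expect_const univ_nonempty]
  simp only [add_zero, zero_add]

/-- **Nested pairs**: `j(A,B,0) = p_A(0) p_B(0)` (the inner increment vanishes, and then so must
the outer one). [cite: Lawler1991, Proposition 6.4.1 (proof, the set A²)] -/
theorem pairJoint_zero_right (A B : ℕ) : pairJoint A B 0 = prob A 0 * prob B 0 := by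
  unfold pairJoint prob
  rw [Finset.expect_mul_expect]
  refine Finset.expect_congr rfl fun α _ => Finset.expect_congr rfl fun β _ => ?_
  rw [Finset.expect_congr rfl fun γ _ => by rw [endpoint_stepSeq_zero γ],
    Finset.expect_const univ_nonempty, add_zero]
  by_cases hβ : endpoint β = 0
  · simp [hβ]
  · simp [hβ]

/-- `j(0,B,C) = p_B(0) p_C(0)`. [cite: Lawler1991, Proposition 6.4.1 (proof, the set A²)] -/
theorem pairJoint_zero_left (B C : ℕ) : pairJoint 0 B C = prob B 0 * prob C 0 := by
  rw [pairJoint_comm, pairJoint_zero_right, mul_comm]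

/-- **`j(A,B,C) = 𝔼_β p_A(Y_B) p_C(Y_B) = Σ_y p_A(y) p_B(y) p_C(y)`**: condition on the shared
increment. [cite: Lawler1991, Proposition 6.4.1 (proof)] -/
theorem pairJoint_eq_expect_prob (A B C : ℕ) :
    pairJoint A B C = 𝔼 β : StepSeq B, prob A (endpoint β) * prob C (endpoint β) := by
  unfold pairJoint
  rw [Finset.expect_comm]
  refine Finset.expect_congr rfl fun β _ => ?_
  rw [← prob_neg A, ← prob_neg C]
  unfold prob
  rw [Finset.expect_mul_expect]
  refine Finset.expect_congr rfl fun α _ => Finset.expect_congr rfl fun γ _ => ?_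
  congr 1
  · exact if_congr (by rw [add_eq_zero_iff_eq_neg]) rfl rfl
  · exact if_congr (by rw [add_comm, add_eq_zero_iff_eq_neg]) rfl rfl

/-- Symmetry of the kernel: `K(A,B,C) = K(C,B,A)`. [folklore] -/
theorem pairKernel_comm (A B C : ℕ) : pairKernel A B C = pairKernel C B A := by
  unfold pairKernel
  rw [pairJoint_comm, mul_comm, add_comm A B, add_comm B C]

/-- **Separated pairs are uncorrelated**: `K(A,0,C) = 0`. [cite: Lawler1991, Proposition 6.4.1 (proof, the set A¹)] -/
theorem pairKernel_zero_mid (A C : ℕ) : pairKernel A 0 C = 0 := by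
  unfold pairKernel
  rw [pairJoint_zero_mid, add_zero, zero_add, sub_self]

/-- **Nested pairs**: `K(A,B,0) = p_B(0) (p_A(0) - p_{A+B}(0))`.
[cite: Lawler1991, Proposition 6.4.1 (proof, the set A²)] -/
theorem pairKernel_zero_right (A B : ℕ) :
    pairKernel A B 0 = prob B 0 * (prob A 0 - prob (A + B) 0) := by
  unfold pairKernel
  rw [pairJoint_zero_right, add_zero]
  ring

/-- `K(0,B,C) = p_B(0) (p_C(0) - p_{B+C}(0))`. [cite: Lawler1991, Proposition 6.4.1 (proof, the set A²)] -/
theorem pairKernel_zero_left (B C : ℕ) :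
    pairKernel 0 B C = prob B 0 * (prob C 0 - prob (B + C) 0) := by
  rw [pairKernel_comm, pairKernel_zero_right, add_comm]

/-! ### The kernel at the overlap data of two pairs of times -/

/-- The number of steps shared by the time intervals spanned by `{i, j}` and `{k, l}`:
`B = (min(i ∨ j, k ∨ l) - max(i ∧ j, k ∧ l))⁺` (truncated subtraction). [cite: Stoll1989, §1 (the blocks [a,ā] × [b,b̄])] -/
def overlapLen (i j k l : ℕ) : ℕ := min (max i j) (max k l) - max (min i j) (min k l)

/-- **The pair kernel at the overlap data of two pairs of times**, the second pair lengthened by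
`2r` private steps: `pairKernelAt r i j k l = K(A, B, C + 2r)` with `B = overlapLen i j k l`,
`A = |j - i| - B`, `C = |l - k| - B`. For `r = 0` this is `Cov(𝟙{ω(i) = ω(j)}, 𝟙{ω(k) = ω(l)})`,
for general `r` it is `Cov(𝟙{ω(i) = ω(j)}, p_{2r}(ω(l) - ω(k)))` (sibling `…PairKernelCovariance`).
[cite: Lawler1991, Proposition 6.4.1 (proof)] [cite: Stoll1989, §3] -/
def pairKernelAt (r i j k l : ℕ) : ℝ :=
  pairKernel (max i j - min i j - overlapLen i j k l) (overlapLen i j k l)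
    (max k l - min k l - overlapLen i j k l + 2 * r)

/-- **The four-fold kernel sum** `Σ_{i,j,k,l < M} pairKernelAt r i j k l` (`Var(J_n)` is a quarter
of `coreSum 0 (n+1)`). [cite: Lawler1991, Proposition 6.4.1 (proof)] -/
def coreSum (r M : ℕ) : ℝ :=
  ∑ i ∈ range M, ∑ j ∈ range M, ∑ k ∈ range M, ∑ l ∈ range M, pairKernelAt r i j k l

/-- `overlapLen` is symmetric in the first pair. [folklore] -/
theorem overlapLen_swap_left (i j k l : ℕ) : overlapLen j i k l = overlapLen i j k l := by
  unfold overlapLen; rw [max_comm j i, min_comm j i]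

/-- `overlapLen` is symmetric in the second pair. [folklore] -/
theorem overlapLen_swap_right (i j k l : ℕ) : overlapLen i j l k = overlapLen i j k l := by
  unfold overlapLen; rw [max_comm l k, min_comm l k]

/-- `overlapLen` is symmetric under exchanging the pairs. [folklore] -/
theorem overlapLen_swap_pairs (i j k l : ℕ) : overlapLen k l i j = overlapLen i j k l := by
  unfold overlapLen; rw [min_comm, max_comm (min k l)]

/-- The overlap is at most the length of the first pair. [folklore] -/
theorem overlapLen_le_left (i j k l : ℕ) : overlapLen i j k l ≤ max i j - min i j := by
  unfold overlapLen; omega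

/-- The overlap is at most the length of the second pair. [folklore] -/
theorem overlapLen_le_right (i j k l : ℕ) : overlapLen i j k l ≤ max k l - min k l := by
  unfold overlapLen; omega

/-- `pairKernelAt` is symmetric in the first pair. [folklore] -/
theorem pairKernelAt_swap_left (r i j k l : ℕ) : pairKernelAt r j i k l = pairKernelAt r i j k l := by
  unfold pairKernelAt; rw [overlapLen_swap_left, max_comm j i, min_comm j i]

/-- `pairKernelAt` is symmetric in the second pair. [folklore] -/
theorem pairKernelAt_swap_right (r i j k l : ℕ) : pairKernelAt r i j l k = pairKernelAt r i j k l := by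
  unfold pairKernelAt; rw [overlapLen_swap_right, max_comm l k, min_comm l k]

/-- For `r = 0`, `pairKernelAt` is symmetric under exchanging the pairs. [folklore] -/
theorem pairKernelAt_zero_swap_pairs (i j k l : ℕ) : pairKernelAt 0 k l i j = pairKernelAt 0 i j k l := by
  unfold pairKernelAt; rw [overlapLen_swap_pairs, mul_zero, add_zero, add_zero, pairKernel_comm]

/-- `|pairKernelAt| ≤ 1`. [folklore] -/
theorem abs_pairKernelAt_le_one (r i j k l : ℕ) : |pairKernelAt r i j k l| ≤ 1 :=
  abs_pairKernel_le_one _ _ _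

/-- A degenerate first pair contributes nothing: `pairKernelAt r i i k l = 0`. [folklore] -/
theorem pairKernelAt_self_left (r i k l : ℕ) : pairKernelAt r i i k l = 0 := by
  unfold pairKernelAt
  have h : overlapLen i i k l = 0 := by unfold overlapLen; omega
  rw [h, pairKernel_zero_mid]

end Edwards2D

end Literature.Barriers.CriticalPhenomena
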